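import Summits.Ventures.PercRepro.RankLevelSetAvgPairs

/-!
# PercRepro — A ONE-PARAMETER SUFFICIENT FORM OF THE BINOMIAL INEQUALITY (night-1, gen 9 session 4; dossier §19.14″)

`csSum p q := Σ_{s=1}^{p−q−1} C(p−q,s)·w(s)/C(s+q+1,q)` (`w(1) = p+q`, `w(s) = p−1−s`) is a lower bound for
`NUM′(p,q,k)/k` for every `1 ≤ k ≤ q` (`numPrime_ge_mul_csSum`): only the `s₁ = 1` terms, `C(p−k,s) ≥ C(p−q,s)`, and
`m̄(q,k,1,s) ≤ C(s+q+1,q)` (Vandermonde).  Hence `CS(p,q) : Φ(p−1,q) ≤ csSum p q` implies the hypothesis `hnum` of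
`avg_contract_le_of_num` (`num_ge_of_cs`).  CS holds (exactly) for every `p` at `q ≤ 5` and for `p > 27 / 79 / 195`
at `q = 6 / 7 / 8` (§19.14″) — it is NOT proved here.

Axioms: standard.
-/

namespace PercRepro

open Finset

/-- The one-parameter sum `Σ_{s=1}^{p−q−1} C(p−q,s)·w̄(1,s)/C(s+q+1,q)`. -/
noncomputable def csSum (p q : ℕ) : ℚ :=
  ∑ s ∈ Finset.Icc 1 (p - q - 1), (((p - q).choose s : ℕ) : ℚ) * wbar p q 1 s / (((s + q + 1).choose q : ℕ) : ℚ)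

/-- `m̄(q,k,1,s) ≤ C(s+q+1,q)`: a partial Vandermonde sum. -/
lemma mbar_one_le (q k s : ℕ) : mbar q k 1 s ≤ (s + q + 1).choose q := by
  unfold mbar
  have hV : ∑ j ∈ Finset.range (q + 1), (s.choose j) * ((q + 1).choose (q - j)) = (s + q + 1).choose q := by
    have h := Nat.add_choose_eq s (q + 1) q
    -- `(s + (q+1)).choose q = Σ_{(i,j) ∈ antidiagonal q} C(s,i) C(q+1,j)`
    rw [Finset.Nat.sum_antidiagonal_eq_sum_range_succ (fun i j => s.choose i * (q + 1).choose j) q] at h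
    rw [show s + q + 1 = s + (q + 1) by ring, ← h]
  rw [← hV]
  apply Finset.sum_le_sum_of_subset_of_nonneg
  · intro j hj
    rw [Finset.mem_range] at hj ⊢
    omega
  · intro _ _ _
    exact Nat.zero_le _

/-- `NUM′(p,q,k) ≥ k · csSum p q` for `1 ≤ k ≤ q`, `q + 2 ≤ p`. -/
theorem numPrime_ge_mul_csSum {p q k : ℕ} (hk : 1 ≤ k) (hkq : k ≤ q) (hpq : q + 2 ≤ p) :
    (k : ℚ) * csSum p q ≤ numPrime p q k := by
  unfold numPrime csSum
  -- keep only the `s₁ = 1` terms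
  have h1 : (1 : ℕ) ∈ Finset.Icc 1 k := by rw [Finset.mem_Icc]; omega
  have hnonneg : ∀ s₁ ∈ Finset.Icc 1 k, 0 ≤ ∑ s₂ ∈ Finset.Icc 1 (p - q - 1),
      ((k.choose s₁ : ℕ) : ℚ) * (((p - k).choose s₂ : ℕ) : ℚ) * wbar p q s₁ s₂ / ((mbar q k s₁ s₂ : ℕ) : ℚ) := by
    intro s₁ hs₁
    rw [Finset.mem_Icc] at hs₁
    refine Finset.sum_nonneg (fun s₂ hs₂ => ?_)
    rw [Finset.mem_Icc] at hs₂
    have hw : 0 ≤ wbar p q s₁ s₂ := by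
      unfold wbar
      split_ifs
      · positivity
      · have : s₁ + s₂ ≤ p := by omega
        have h' : (s₁ : ℚ) + (s₂ : ℚ) ≤ (p : ℚ) := by exact_mod_cast this
        linarith
    positivity
  refine le_trans ?_ (Finset.single_le_sum hnonneg h1)
  rw [Finset.mul_sum]
  refine Finset.sum_le_sum (fun s hs => ?_)
  rw [Finset.mem_Icc] at hs
  rw [Nat.choose_one_right]
  -- `C(p−q,s) ≤ C(p−k,s)` and `m̄ ≤ C(s+q+1,q)`
  have hc : (((p - q).choose s : ℕ) : ℚ) ≤ (((p - k).choose s : ℕ) : ℚ) := by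
    exact_mod_cast Nat.choose_le_choose s (by omega : p - q ≤ p - k)
  have hm : ((mbar q k 1 s : ℕ) : ℚ) ≤ (((s + q + 1).choose q : ℕ) : ℚ) := by
    exact_mod_cast mbar_one_le q k s
  have hm0 : (0 : ℚ) < ((mbar q k 1 s : ℕ) : ℚ) := by exact_mod_cast one_le_mbar q k 1 s
  have hw : 0 ≤ wbar p q 1 s := by
    unfold wbar
    split_ifs
    · positivity
    · have : 1 + s ≤ p := by omega
      have h' : (1 : ℚ) + (s : ℚ) ≤ (p : ℚ) := by exact_mod_cast this
      have h'' : (0 : ℚ) ≤ (p : ℚ) - ((1 : ℕ) : ℚ) - (s : ℚ) := by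
        rw [Nat.cast_one]; linarith
      exact h''
  calc (k : ℚ) * ((((p - q).choose s : ℕ) : ℚ) * wbar p q 1 s / (((s + q + 1).choose q : ℕ) : ℚ))
      = (k : ℚ) * (((p - q).choose s : ℕ) : ℚ) * wbar p q 1 s / (((s + q + 1).choose q : ℕ) : ℚ) := by ring
    _ ≤ (k : ℚ) * (((p - q).choose s : ℕ) : ℚ) * wbar p q 1 s / ((mbar q k 1 s : ℕ) : ℚ) := by
        apply div_le_div_of_nonneg_left _ hm0 hm
        positivity
    _ ≤ (k : ℚ) * (((p - k).choose s : ℕ) : ℚ) * wbar p q 1 s / ((mbar q k 1 s : ℕ) : ℚ) := by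
        apply div_le_div_of_nonneg_right _ hm0.le
        apply mul_le_mul_of_nonneg_right _ hw
        exact mul_le_mul_of_nonneg_left hc (Nat.cast_nonneg k)

/-- **`CS(p,q)` implies the hypothesis of `avg_contract_le_of_num`.** -/
theorem num_ge_of_cs {p q : ℕ} (hpq : q + 2 ≤ p) (hcs : phiK (p - 1) q ≤ csSum p q) :
    ∀ k : ℕ, 1 ≤ k → k ≤ q → phiK (p - 1) q * (k : ℚ) ≤ numPrime p q k := by
  intro k hk hkq
  calc phiK (p - 1) q * (k : ℚ) ≤ csSum p q * (k : ℚ) :=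
        mul_le_mul_of_nonneg_right hcs (Nat.cast_nonneg k)
    _ = (k : ℚ) * csSum p q := by ring
    _ ≤ numPrime p q k := numPrime_ge_mul_csSum hk hkq hpq

end PercRepro
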